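import Literature.Analysis.FluidPDE.ClassicalL2Stability
import HarnessLib

/-!
# `L²` stability of classical solutions of the FORCED system in the smooth `H¹` class
# (Robinson–Rodrigo–Sadowski 2016, (6.3) and the proof of Thm. 6.10; Tao 2013, Thm. 5.4 (v))

Analysis/FluidPDE proof file (no named facts, no definitions). This is the forced twin of the
tree's `exists_l2_stability` (`ClassicalL2Stability.lean`): for two classical solutions `(u, p)`,
`(u', p')` of the Navier–Stokes system with the SAME force `f` and the same viscosity `ν > 0` on a
closed slab `[0, T] × ℝ³`, both in the `L²`-Sobolev class of Tao's smooth `H¹` theory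
(`u, ∂ₜu, p ∈ L^∞_t H^k_x`) and with square-integrable force slices `f(t) ∈ L²(ℝ³)`, the
difference `w = u − u'` obeys

  `‖w(t)‖²_{L²} ≤ ‖w(0)‖²_{L²} exp (C ν⁻³ S² t)`,   `S ≥ sup_{[0,T]} ∫ |∇u'|²`,

with the SAME absolute constant `C` as in the homogeneous statement (`exists_l2_stability_forced`).
The force cancels in the equation for the difference,
`∂ₜw + (u·∇)w + (w·∇)u' = νΔw − ∇(p − p')`, so the estimate and its proof are those of
Robinson–Rodrigo–Sadowski 2016, proof of Thm. 6.10 (PDF p. 106: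
`½ d/dt ‖w‖² + ‖∇w‖² ≤ |⟨(w·∇)u, w⟩| ≤ c‖∇u‖⁴‖w‖² + ½‖∇w‖²`, "the Gronwall Lemma yields
`‖w(t)‖² ≤ ‖w(0)‖² exp(c∫₀ᵗ‖∇u‖⁴)`") and (6.3), verbatim; it is the `L²` part of Tao 2013,
Thm. 5.4 (v) (Lipschitz stability) in the inhomogeneous case. It is the convergence mechanism of
the approximation scheme behind the forced local `H¹` theory
`tao2011_forced_H1_local_almost_regular` (smooth data `u₀ⁿ → u₀`, one common force, give solutions
Cauchy in `C_t L²_x`).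

## The argument (mechanical port of `exists_l2_stability`)

1. `IsSmoothSpaceTimeOn.l2_balance` for `w = u − u'` (force-free statement about a smooth field).
2. The tree's ABSTRACT slice inequality `exists_l2_slice` is stated for fields `Wᵢ` with
   `Wᵢ + (vᵢ·∇)vᵢ = νΔvᵢ − ∇qᵢ`; we feed it `Wᵢ := ∂ₜuᵢ(t) − f(t)` (the forced momentum equation
   rearranged), whose difference is `∂ₜu(t) − ∂ₜu'(t)`. The slices `f(t)` are `C^∞` because the
   force of a classical solution is jointly smooth (`IsClassicalNSSolutionOn.isSmoothSpaceTimeOn_force`),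
   and `∂ₜuᵢ(t) − f(t) ∈ L²` by the hypothesis `f(t) ∈ L²`.
3. Grönwall (`le_mul_exp_of_le_add_mul_integral`).

## References

* J. C. Robinson, J. L. Rodrigo, W. Sadowski, *The Three-Dimensional Navier–Stokes Equations*,
  CUP 2016, Thm. 6.10 (proof, PDF p. 106) and (6.3). [RobinsonRodrigoSadowski2016]
* T. Tao, Anal. PDE 6 (2013) = arXiv:1108.1165, Thm. 5.4 (v). [Tao2011]
-/

noncomputable section

open MeasureTheory Set Function Filter InnerProductSpace
open _root_.Topology
open scoped ENNReal NNReal ContDiff RealInnerProductSpace Laplacian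

namespace Literature.Analysis.FluidPDE

section Slab

set_option maxHeartbeats 800000 in
/-- **`L²` stability of classical solutions of the forced system in the smooth `H¹` class**
(Robinson–Rodrigo–Sadowski 2016, proof of Thm. 6.10 and (6.3); Tao 2011, Thm. 5.4 (v), `L²`
part; forced twin of `exists_l2_stability`): there is an absolute constant `C ≥ 0` such that for
two classical solutions `(u, p)`, `(u', p')` of the Navier–Stokes system with the SAME force `f`
(same viscosity `ν > 0`) on `[0, T] × ℝ³`, both with `u, ∂ₜu, p ∈ L^∞_t H^k_x` for all `k`, with
force slices `f(t) ∈ L²(ℝ³)` for `t ∈ [0, T]`, and `S ≥ ∫|∇u'(t)|²` on `[0, T]`: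
`∫‖u(t) − u'(t)‖² ≤ ∫‖u(0) − u'(0)‖² · exp(C ν⁻³ S² t)` for all `t ∈ [0, T]`.
Proof: `IsSmoothSpaceTimeOn.l2_balance` for `w = u − u'`, the slice inequality `exists_l2_slice`
at every time with `Wᵢ = ∂ₜuᵢ − f` (the force cancels in the difference), and Grönwall's lemma
(`le_mul_exp_of_le_add_mul_integral`).
[cite: RobinsonRodrigoSadowski2016, Thm. 6.10 (proof) and (6.3)] -/
theorem exists_l2_stability_forced :
    ∃ C : ℝ, 0 ≤ C ∧ ∀ ⦃ν T : ℝ⦄ (_ : 0 < ν) (_ : 0 < T)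
      ⦃f : ℝ → EuclideanSpace ℝ (Fin 3) → EuclideanSpace ℝ (Fin 3)⦄
      ⦃u u' : ℝ → EuclideanSpace ℝ (Fin 3) → EuclideanSpace ℝ (Fin 3)⦄
      ⦃p p' : ℝ → EuclideanSpace ℝ (Fin 3) → ℝ⦄
      (_ : FluidPDE.IsClassicalNSSolutionOn (Icc 0 T) ν f u p)
      (_ : FluidPDE.IsClassicalNSSolutionOn (Icc 0 T) ν f u' p')
      (_ : ∀ t ∈ Icc 0 T, ∫⁻ x, ‖f t x‖ₑ ^ 2 < ⊤)
      (_ : HasBoundedSobolevNormsOn (Icc 0 T) u)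
      (_ : HasBoundedSobolevNormsOn (Icc 0 T) (FluidPDE.timeDerivWithin (Icc 0 T) u))
      (_ : ∀ n : ℕ, ∃ C' : ℝ≥0, ∀ t ∈ Icc 0 T, ∫⁻ x, ‖iteratedFDeriv ℝ n (p t) x‖ₑ ^ 2 ≤ C')
      (_ : HasBoundedSobolevNormsOn (Icc 0 T) u')
      (_ : HasBoundedSobolevNormsOn (Icc 0 T) (FluidPDE.timeDerivWithin (Icc 0 T) u'))
      (_ : ∀ n : ℕ, ∃ C' : ℝ≥0, ∀ t ∈ Icc 0 T, ∫⁻ x, ‖iteratedFDeriv ℝ n (p' t) x‖ₑ ^ 2 ≤ C')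
      ⦃S : ℝ⦄ (_ : ∀ t ∈ Icc 0 T, ∫ x, FluidPDE.frobeniusNormSq (fderiv ℝ (u' t) x) ≤ S),
      ∀ t ∈ Icc 0 T, ∫ x, ‖u t x - u' t x‖ ^ 2 ≤
        (∫ x, ‖u 0 x - u' 0 x‖ ^ 2) * Real.exp (C * (ν ^ 3)⁻¹ * S ^ 2 * t) := by
  obtain ⟨C, hC0, hslice⟩ := exists_l2_slice
  refine ⟨C, hC0, ?_⟩
  intro ν T hν hT f u u' p p' hsol hsol' hfL2 hu hut hp hu' hut' hp' S hS
  have hU : UniqueDiffOn ℝ (Icc 0 T) := uniqueDiffOn_Icc hT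
  -- the force is jointly smooth (it is determined by the equation)
  have hfs : FluidPDE.IsSmoothSpaceTimeOn (Icc 0 T) f := hsol.isSmoothSpaceTimeOn_force hU
  -- the difference and its time derivative
  obtain ⟨w, hwdef⟩ : ∃ w : ℝ → EuclideanSpace ℝ (Fin 3) → EuclideanSpace ℝ (Fin 3),
      w = fun t x => u t x - u' t x := ⟨_, rfl⟩
  have hwtx : ∀ t x, w t x = u t x - u' t x := fun t x => by rw [hwdef]
  have hwsm : FluidPDE.IsSmoothSpaceTimeOn (Icc 0 T) w := by
    rw [hwdef]; exact hsol.smooth_velocity.sub hsol'.smooth_velocity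
  have hWt : ∀ t ∈ Icc 0 T, ∀ x, FluidPDE.timeDerivWithin (Icc 0 T) w t x =
      FluidPDE.timeDerivWithin (Icc 0 T) u t x - FluidPDE.timeDerivWithin (Icc 0 T) u' t x := by
    intro t ht x
    rw [hwdef]
    exact hsol.smooth_velocity.timeDerivWithin_fun_sub hsol'.smooth_velocity hU ht x
  -- class bounds
  obtain ⟨B, hB⟩ := linfty_bound_of_hasBoundedSobolevNormsOn_holds
    (fun t ht => (hsol.contDiff_velocity ht).of_le (by norm_cast)) hu
  obtain ⟨B', hB'⟩ := linfty_bound_of_hasBoundedSobolevNormsOn_holds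
    (fun t ht => (hsol'.contDiff_velocity ht).of_le (by norm_cast)) hu'
  obtain ⟨C₀, hC₀⟩ := hu 0
  obtain ⟨C₁, hC₁⟩ := hu 1
  obtain ⟨C₂, hC₂⟩ := hu 2
  obtain ⟨C₀', hC₀'⟩ := hu' 0
  obtain ⟨C₁', hC₁'⟩ := hu' 1
  obtain ⟨C₂', hC₂'⟩ := hu' 2
  obtain ⟨E₀, hE₀⟩ := hut 0
  obtain ⟨E₀', hE₀'⟩ := hut' 0
  obtain ⟨P₀, hP₀⟩ := hp 0
  obtain ⟨P₁, hP₁⟩ := hp 1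
  obtain ⟨P₀', hP₀'⟩ := hp' 0
  obtain ⟨P₁', hP₁'⟩ := hp' 1
  have hzero : ∀ {g : EuclideanSpace ℝ (Fin 3) → EuclideanSpace ℝ (Fin 3)} {C' : ℝ≥0},
      (∫⁻ x, ‖iteratedFDeriv ℝ 0 g x‖ₑ ^ 2 ≤ C') → ∫⁻ x, ‖g x‖ₑ ^ 2 ≤ C' := by
    intro g C' h
    refine (le_of_eq (lintegral_congr fun x => ?_)).trans h
    rw [← ofReal_norm, ← ofReal_norm, norm_iteratedFDeriv_zero]
  have hzero' : ∀ {g : EuclideanSpace ℝ (Fin 3) → ℝ} {C' : ℝ≥0},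
      (∫⁻ x, ‖iteratedFDeriv ℝ 0 g x‖ₑ ^ 2 ≤ C') → ∫⁻ x, ‖g x‖ₑ ^ 2 < ⊤ := by
    intro g C' h
    refine lt_of_le_of_lt ((le_of_eq (lintegral_congr fun x => ?_)).trans h) ENNReal.coe_lt_top
    rw [← ofReal_norm, ← ofReal_norm, norm_iteratedFDeriv_zero]
  -- `L²` bounds for `w` and `∂ₜ w`
  have hwL2 : ∀ t ∈ Icc 0 T, ∫⁻ x, ‖w t x‖ₑ ^ 2 ≤ (2 * C₀ + 2 * C₀' : ℝ≥0) := by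
    intro t ht
    have h := lintegral_enorm_sq_sub_le (g := u' t) ((hsol.contDiff_velocity ht).continuous.aestronglyMeasurable)
      (μ := volume)
    calc ∫⁻ x, ‖w t x‖ₑ ^ 2 = ∫⁻ x, ‖u t x - u' t x‖ₑ ^ 2 := lintegral_congr fun x => by rw [hwtx]
      _ ≤ 2 * (∫⁻ x, ‖u t x‖ₑ ^ 2) + 2 * ∫⁻ x, ‖u' t x‖ₑ ^ 2 := h
      _ ≤ 2 * (C₀ : ℝ≥0∞) + 2 * (C₀' : ℝ≥0∞) := by
          gcongr
          · exact hzero (hC₀ t ht)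
          · exact hzero (hC₀' t ht)
      _ = ((2 * C₀ + 2 * C₀' : ℝ≥0) : ℝ≥0∞) := by push_cast; rfl
  have hWL2 : ∀ t ∈ Icc 0 T, ∫⁻ x, ‖FluidPDE.timeDerivWithin (Icc 0 T) w t x‖ₑ ^ 2 ≤
      (2 * E₀ + 2 * E₀' : ℝ≥0) := by
    intro t ht
    have hsm := (hsol.smooth_velocity.timeDerivWithin hU).contDiff_slice ht
    have h := lintegral_enorm_sq_sub_le (g := FluidPDE.timeDerivWithin (Icc 0 T) u' t)
      (hsm.continuous.aestronglyMeasurable) (μ := volume)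
    calc ∫⁻ x, ‖FluidPDE.timeDerivWithin (Icc 0 T) w t x‖ₑ ^ 2
        = ∫⁻ x, ‖FluidPDE.timeDerivWithin (Icc 0 T) u t x - FluidPDE.timeDerivWithin (Icc 0 T) u' t x‖ₑ ^ 2 :=
          lintegral_congr fun x => by rw [hWt t ht]
      _ ≤ 2 * (∫⁻ x, ‖FluidPDE.timeDerivWithin (Icc 0 T) u t x‖ₑ ^ 2) +
          2 * ∫⁻ x, ‖FluidPDE.timeDerivWithin (Icc 0 T) u' t x‖ₑ ^ 2 := h
      _ ≤ 2 * (E₀ : ℝ≥0∞) + 2 * (E₀' : ℝ≥0∞) := by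
          gcongr
          · exact hzero (hE₀ t ht)
          · exact hzero (hE₀' t ht)
      _ = ((2 * E₀ + 2 * E₀' : ℝ≥0) : ℝ≥0∞) := by push_cast; rfl
  -- the balance
  obtain ⟨hΦint, hEcont, hEb⟩ := hwsm.l2_balance hT hwL2 hWL2
  obtain ⟨E, hEdef⟩ : ∃ E : ℝ → ℝ, E = fun t => ∫ x, ‖w t x‖ ^ 2 := ⟨_, rfl⟩
  have hEt : ∀ t, E t = ∫ x, ‖w t x‖ ^ 2 := fun t => by rw [hEdef]
  obtain ⟨Φ, hΦdef⟩ : ∃ Φ : ℝ → ℝ,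
      Φ = fun t => ∫ x, 2 * ⟪w t x, FluidPDE.timeDerivWithin (Icc 0 T) w t x⟫ := ⟨_, rfl⟩
  have hΦt : ∀ t, Φ t = ∫ x, 2 * ⟪w t x, FluidPDE.timeDerivWithin (Icc 0 T) w t x⟫ :=
    fun t => by rw [hΦdef]
  rw [← hΦdef] at hΦint
  rw [← hEdef] at hEcont
  have hEb' : ∀ b ∈ Ioc 0 T, E b = E 0 + ∫ t in (0 : ℝ)..b, Φ t := by
    intro b hb
    rw [hEt, hEt, hΦdef]
    exact hEb b hb
  have hE0 : ∀ t, 0 ≤ E t := fun t => by rw [hEt]; exact integral_nonneg fun x => sq_nonneg _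
  -- the slice inequality at each time: `Φ t ≤ κ E t`
  set κ : ℝ := C * (ν ^ 3)⁻¹ * S ^ 2 with hκ
  have hS0 : 0 ≤ S := le_trans (integral_nonneg fun x => FluidPDE.frobeniusNormSq_nonneg _)
    (hS 0 ⟨le_rfl, hT.le⟩)
  have hκ0 : 0 ≤ κ := by positivity
  have hslab : ∀ t ∈ Icc 0 T, Φ t ≤ κ * E t := by
    intro t ht
    set Bm : ℝ := max B B' with hBm
    -- the reduced accelerations `Wᵢ := ∂ₜuᵢ(t) − f(t)` (the force moved to the left-hand side)
    obtain ⟨W₁, hW₁def⟩ : ∃ W₁ : EuclideanSpace ℝ (Fin 3) → EuclideanSpace ℝ (Fin 3),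
        W₁ = fun x => FluidPDE.timeDerivWithin (Icc 0 T) u t x - f t x := ⟨_, rfl⟩
    obtain ⟨W₂, hW₂def⟩ : ∃ W₂ : EuclideanSpace ℝ (Fin 3) → EuclideanSpace ℝ (Fin 3),
        W₂ = fun x => FluidPDE.timeDerivWithin (Icc 0 T) u' t x - f t x := ⟨_, rfl⟩
    have hW₁x : ∀ x, W₁ x = FluidPDE.timeDerivWithin (Icc 0 T) u t x - f t x := fun x => by
      rw [hW₁def]
    have hW₂x : ∀ x, W₂ x = FluidPDE.timeDerivWithin (Icc 0 T) u' t x - f t x := fun x => by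
      rw [hW₂def]
    have hft : ContDiff ℝ ∞ (f t) := hfs.contDiff_slice ht
    have hW₁c : ContDiff ℝ 1 W₁ := by
      rw [hW₁def]
      exact (((hsol.smooth_velocity.timeDerivWithin hU).contDiff_slice ht).sub hft).of_le
        (by norm_cast)
    have hW₂c : ContDiff ℝ 1 W₂ := by
      rw [hW₂def]
      exact (((hsol'.smooth_velocity.timeDerivWithin hU).contDiff_slice ht).sub hft).of_le
        (by norm_cast)
    have hmom : ∀ x, W₁ x + FluidPDE.convect (u t) (u t) x = ν • (Δ (u t)) x - gradient (p t) x := by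
      intro x
      have h := hsol.momentum t ht x
      rw [hW₁x, sub_add_eq_add_sub, h, add_sub_cancel_right]
    have hmom' : ∀ x, W₂ x + FluidPDE.convect (u' t) (u' t) x =
        ν • (Δ (u' t)) x - gradient (p' t) x := by
      intro x
      have h := hsol'.momentum t ht x
      rw [hW₂x, sub_add_eq_add_sub, h, add_sub_cancel_right]
    have hW₁L2 : ∫⁻ x, ‖W₁ x‖ₑ ^ 2 < ⊤ := by
      have hsm := (hsol.smooth_velocity.timeDerivWithin hU).contDiff_slice ht
      have h := lintegral_enorm_sq_sub_le (g := f t) (hsm.continuous.aestronglyMeasurable)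
        (μ := volume) (f := FluidPDE.timeDerivWithin (Icc 0 T) u t)
      calc ∫⁻ x, ‖W₁ x‖ₑ ^ 2 = ∫⁻ x, ‖FluidPDE.timeDerivWithin (Icc 0 T) u t x - f t x‖ₑ ^ 2 :=
            lintegral_congr fun x => by rw [hW₁x]
        _ ≤ 2 * (∫⁻ x, ‖FluidPDE.timeDerivWithin (Icc 0 T) u t x‖ₑ ^ 2) + 2 * ∫⁻ x, ‖f t x‖ₑ ^ 2 := h
        _ < ⊤ := by
            refine ENNReal.add_lt_top.2 ⟨ENNReal.mul_lt_top (by simp) ?_, ENNReal.mul_lt_top (by simp) (hfL2 t ht)⟩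
            exact (hzero (hE₀ t ht)).trans_lt ENNReal.coe_lt_top
    have hW₂L2 : ∫⁻ x, ‖W₂ x‖ₑ ^ 2 < ⊤ := by
      have hsm := (hsol'.smooth_velocity.timeDerivWithin hU).contDiff_slice ht
      have h := lintegral_enorm_sq_sub_le (g := f t) (hsm.continuous.aestronglyMeasurable)
        (μ := volume) (f := FluidPDE.timeDerivWithin (Icc 0 T) u' t)
      calc ∫⁻ x, ‖W₂ x‖ₑ ^ 2 = ∫⁻ x, ‖FluidPDE.timeDerivWithin (Icc 0 T) u' t x - f t x‖ₑ ^ 2 :=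
            lintegral_congr fun x => by rw [hW₂x]
        _ ≤ 2 * (∫⁻ x, ‖FluidPDE.timeDerivWithin (Icc 0 T) u' t x‖ₑ ^ 2) + 2 * ∫⁻ x, ‖f t x‖ₑ ^ 2 := h
        _ < ⊤ := by
            refine ENNReal.add_lt_top.2 ⟨ENNReal.mul_lt_top (by simp) ?_, ENNReal.mul_lt_top (by simp) (hfL2 t ht)⟩
            exact (hzero (hE₀' t ht)).trans_lt ENNReal.coe_lt_top
    have hsl := hslice hν ((hsol.contDiff_velocity ht).of_le (by norm_cast))
      ((hsol'.contDiff_velocity ht).of_le (by norm_cast)) hW₁c hW₂c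
      ((hsol.contDiff_pressure ht).of_le (by norm_cast)) ((hsol'.contDiff_pressure ht).of_le (by norm_cast))
      hmom hmom' (hsol.divFree t ht) (hsol'.divFree t ht)
      (fun x => (hB t ht x).trans (le_max_left B B')) (fun x => (hB' t ht x).trans (le_max_right B B'))
      ((hzero (hC₀ t ht)).trans_lt ENNReal.coe_lt_top) ((hC₁ t ht).trans_lt ENNReal.coe_lt_top)
      ((hC₂ t ht).trans_lt ENNReal.coe_lt_top)
      ((hzero (hC₀' t ht)).trans_lt ENNReal.coe_lt_top) ((hC₁' t ht).trans_lt ENNReal.coe_lt_top)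
      ((hC₂' t ht).trans_lt ENNReal.coe_lt_top)
      hW₁L2 hW₂L2
      (hzero' (hP₀ t ht)) ((hP₁ t ht).trans_lt ENNReal.coe_lt_top)
      (hzero' (hP₀' t ht)) ((hP₁' t ht).trans_lt ENNReal.coe_lt_top)
    -- the force cancels: `W₁ − W₂ = ∂ₜu t − ∂ₜu' t`
    have hWW : ∀ x, W₁ x - W₂ x =
        FluidPDE.timeDerivWithin (Icc 0 T) u t x - FluidPDE.timeDerivWithin (Icc 0 T) u' t x := fun x => by
      rw [hW₁x, hW₂x, sub_sub_sub_cancel_right]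
    -- `Φ t = 2 ∫ ⟪u t - u' t, ∂ₜu t - ∂ₜu' t⟫`
    have hΦeq : Φ t = 2 * ∫ x, ⟪u t x - u' t x, W₁ x - W₂ x⟫ := by
      rw [hΦt, integral_const_mul]
      congr 1
      exact integral_congr_ae (Eventually.of_forall fun x => by simp only [hwtx, hWt t ht, hWW])
    have hEeq : E t = ∫ x, ‖u t x - u' t x‖ ^ 2 := by
      rw [hEt]; exact integral_congr_ae (Eventually.of_forall fun x => by simp only [hwtx])
    have hG : (∫ x, FluidPDE.frobeniusNormSq (fderiv ℝ (u' t) x)) ^ 2 ≤ S ^ 2 :=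
      pow_le_pow_left₀ (integral_nonneg fun x => FluidPDE.frobeniusNormSq_nonneg _) (hS t ht) 2
    rw [hΦeq, hEeq, hκ]
    refine hsl.trans ?_
    have hEnn : 0 ≤ ∫ x, ‖u t x - u' t x‖ ^ 2 := integral_nonneg fun x => sq_nonneg _
    have hν3 : 0 ≤ (ν ^ 3)⁻¹ := by positivity
    have := mul_le_mul_of_nonneg_left hG (mul_nonneg hC0 hν3)
    nlinarith [this, hEnn]
  -- Grönwall
  have hle : ∀ t ∈ Icc 0 T, E t ≤ E 0 + κ * ∫ s in (0 : ℝ)..t, E s := by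
    intro t ht
    rcases eq_or_lt_of_le ht.1 with h0 | h0
    · rw [← h0, intervalIntegral.integral_same, mul_zero, add_zero]
    have hΦii : IntervalIntegrable Φ volume 0 t :=
      (intervalIntegrable_iff_integrableOn_Ioo_of_le h0.le).2
        (hΦint.mono_set (Ioo_subset_Ioo le_rfl ht.2))
    have hEc : ContinuousOn (fun s => κ * E s) (Icc 0 t) :=
      continuousOn_const.mul (hEcont.mono (Icc_subset_Icc le_rfl ht.2))
    have hmono : ∫ s in (0 : ℝ)..t, Φ s ≤ ∫ s in (0 : ℝ)..t, κ * E s :=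
      intervalIntegral.integral_mono_on h0.le hΦii (hEc.intervalIntegrable_of_Icc h0.le)
        fun s hs => hslab s ⟨hs.1, hs.2.trans ht.2⟩
    rw [hEb' t ⟨h0, ht.2⟩]
    rw [intervalIntegral.integral_const_mul] at hmono
    linarith
  have hgron := le_mul_exp_of_le_add_mul_integral hEcont hκ0 hle
  intro t ht
  have h := hgron t ht
  rw [hEt, hEt] at h
  have e1 : ∫ x, ‖w t x‖ ^ 2 = ∫ x, ‖u t x - u' t x‖ ^ 2 :=
    integral_congr_ae (Eventually.of_forall fun x => by simp only [hwtx])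
  have e0 : ∫ x, ‖w 0 x‖ ^ 2 = ∫ x, ‖u 0 x - u' 0 x‖ ^ 2 :=
    integral_congr_ae (Eventually.of_forall fun x => by simp only [hwtx])
  rw [e1, e0] at h
  exact h

/-- **Uniform-in-time form** of `exists_l2_stability_forced` (the shape consumed by the uniform
`L²`-Cauchy property of an approximation scheme): with the same constant `C`,
`∫‖u(t) − u'(t)‖² ≤ ∫‖u(0) − u'(0)‖² · exp(C ν⁻³ S² T)` for all `t ∈ [0, T]`.
[cite: RobinsonRodrigoSadowski2016, Thm. 6.10 (proof) and (6.3)] -/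
theorem exists_l2_stability_forced_uniform :
    ∃ C : ℝ, 0 ≤ C ∧ ∀ ⦃ν T : ℝ⦄ (_ : 0 < ν) (_ : 0 < T)
      ⦃f : ℝ → EuclideanSpace ℝ (Fin 3) → EuclideanSpace ℝ (Fin 3)⦄
      ⦃u u' : ℝ → EuclideanSpace ℝ (Fin 3) → EuclideanSpace ℝ (Fin 3)⦄
      ⦃p p' : ℝ → EuclideanSpace ℝ (Fin 3) → ℝ⦄
      (_ : FluidPDE.IsClassicalNSSolutionOn (Icc 0 T) ν f u p)
      (_ : FluidPDE.IsClassicalNSSolutionOn (Icc 0 T) ν f u' p')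
      (_ : ∀ t ∈ Icc 0 T, ∫⁻ x, ‖f t x‖ₑ ^ 2 < ⊤)
      (_ : HasBoundedSobolevNormsOn (Icc 0 T) u)
      (_ : HasBoundedSobolevNormsOn (Icc 0 T) (FluidPDE.timeDerivWithin (Icc 0 T) u))
      (_ : ∀ n : ℕ, ∃ C' : ℝ≥0, ∀ t ∈ Icc 0 T, ∫⁻ x, ‖iteratedFDeriv ℝ n (p t) x‖ₑ ^ 2 ≤ C')
      (_ : HasBoundedSobolevNormsOn (Icc 0 T) u')
      (_ : HasBoundedSobolevNormsOn (Icc 0 T) (FluidPDE.timeDerivWithin (Icc 0 T) u'))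
      (_ : ∀ n : ℕ, ∃ C' : ℝ≥0, ∀ t ∈ Icc 0 T, ∫⁻ x, ‖iteratedFDeriv ℝ n (p' t) x‖ₑ ^ 2 ≤ C')
      ⦃S : ℝ⦄ (_ : ∀ t ∈ Icc 0 T, ∫ x, FluidPDE.frobeniusNormSq (fderiv ℝ (u' t) x) ≤ S),
      ∀ t ∈ Icc 0 T, ∫ x, ‖u t x - u' t x‖ ^ 2 ≤
        (∫ x, ‖u 0 x - u' 0 x‖ ^ 2) * Real.exp (C * (ν ^ 3)⁻¹ * S ^ 2 * T) := by
  obtain ⟨C, hC0, hstab⟩ := exists_l2_stability_forced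
  refine ⟨C, hC0, ?_⟩
  intro ν T hν hT f u u' p p' hsol hsol' hfL2 hu hut hp hu' hut' hp' S hS t ht
  have h := hstab hν hT hsol hsol' hfL2 hu hut hp hu' hut' hp' hS t ht
  refine h.trans (mul_le_mul_of_nonneg_left (Real.exp_le_exp.2 ?_) (integral_nonneg fun x => sq_nonneg _))
  have hS0 : 0 ≤ S := le_trans (integral_nonneg fun x => FluidPDE.frobeniusNormSq_nonneg _)
    (hS 0 ⟨le_rfl, hT.le⟩)
  have : 0 ≤ C * (ν ^ 3)⁻¹ * S ^ 2 := by positivity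
  exact mul_le_mul_of_nonneg_left ht.2 this

end Slab

end Literature.Analysis.FluidPDE

end
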